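import Literature.MathematicalPhysics.QuantumFieldTheory.Balaban1983to89.T3AlphaInputsACTwoRunLevel

/-!
# Crux idea seat `ym-cruxidea-19201-1` (ideator 1 of 2, lens: transfer), gen 5 — SKETCH for card 5 `e1-second-order-kantorovich`, RE-CUT (g5)

Crux of record: stmt-QuantumFields-19201 `FluctuationComparisonRegPr` (aside) ∕ live twin stmt-QuantumFields-19935 `FluctuationComparisonRegPrL`
(registered line `Cruxes/FluctuationComparisonRegPrL/Lines/birth_v5h.lean`, STUB 3′ `stub_alphaTwoRunOfLane`, row `PolymerCauchyMinAt` of `TwoRunMin`);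
served target e1 = `T3AlphaInputsACTwoRun.MinimiserCauchyAt F γ ε₀ b₀ p₀ a₁` (consumer: landed `LogComparisonLevelCauchyTriv.cauchyAtHeights_of_trivRows`).

WHY A RE-CUT.  Card 5 (g4) typed e1 as «exact lift is near-critical with a UNIFORM sup Euler–Lagrange residual of relative order L^{−(1+a₁)k}» (K1) +
«ℓ^∞ Kantorovich with ‖G_k‖_{∞→∞} ≍ L^{2k}» (K2) + averaging Lipschitz (K3).  The g5 toy (`toy/toy_e1_residual.py`, exact Fourier, linearised∕abelian model
with rough iid unit-scale block data) REFUTES K1 AS TYPED: the sup EL-residual of the coarsened fine solution `C u_{k+1}` for the coarse problem is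
RELATIVELY O(1) and NON-DECAYING in k, carried entirely by bonds within distance L of block faces (share 1.000): d=1 0.215 (plain) ∕ 0.898 (smear-1) ∕ 0.294
(L=3); d=2 0.303 ∕ 0.333; d=3 (L=2, n_b=2) r∕g = 0.220, 0.237, 0.288, 0.316 (k=2..5) — while the DEFECT itself still has γ_det → 2 (sup|δ_k| exponents
1.224, 1.754, 1.827 in d=3; 1.994, 2.000 in d=1) and energy exponent → 3∕2.  So e1 (a₁ = 1⁻) survives but the K1∕K2 cut is wrong: the residual is a
lattice-scale multipole layer at block faces, large in sup norm, small only against the two-derivative Green's function.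

THE RE-CUT (this file).  Structural fact (exact, no estimate): by the semigroup property of the block averages ((0.11)) and min–min,
`w := coarsenField U′` (U′ = run-(K+1) regular minimiser of the datum V) is the argmin over run K's fibre `fibre F ℰp n K h V` of
`A^{(1)}(W) := sInf (wilsonAction4 '' (fibre F ℰp K (K+1) (Nat.le_succ K) W ∩ {U″ | RegPr F n (K+1) ε₀ U″}))` (fibre semigroup `T3DescentFibreTower` + min–min;
typeable with tree notions), i.e. of `A_K + 𝒟` with the ONE-STEP CLASSICAL DEFECT FUNCTIONAL `𝒟 := L^{4−d}·A^{(1)} − A_K` (d = 3: weight `L`, the unique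
weight making the `F²` parts cancel; the argmin is weight-independent) — a gauge-invariant, centre-reflection- and axis-permutation-invariant, quasi-local,
analytic functional of ONE run's field, INDEPENDENT of k (always one averaging step of ratio L), whose Symanzik expansion starts at dimension 6 (consistency
⇒ no F² term; gauge invariance + the hyperoctahedral symmetries ⇒ no dimension-5 term — the classification «no dimension-five operators, three dimension-six
operators» [DeGrand–DeTar §10.2.1 (10.3)–(10.4) p.155; Lüscher–Weisz CMP 97 (1985) 59]; the symmetries are IN THE TREE for every `L`:
`BlockAveraging.avgFun_creflect`∕`blockAvg_creflect` (c_ρ = reflect ρ ∘ translate (−e_ρ), [Balaban1987RG1 (2.17)]), `avgFun_permute`, `avgFun_translate`;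
the naive site reflection is NOT a symmetry: `AveragingReflection.not_reflect_equivariant`): leading part `c Σ_b |(D*F)(b)|² + c′ Σ_{x,μ,ν} |D_μF_{μν}|²` + `F³`.
THE DIMENSION-5 EXCLUSION IS LOAD-BEARING: a dimension-5 term (parity-odd quadratic `F·∇F`, possible for vector-valued fields without the reflections)
would give `μ₁ ~ θ(n)x²` and `a₁ = 0⁻`.
Hence the minimiser w of `A_K + 𝒟` is near-critical for `A_K` in a STRUCTURED pairing — first variation of 𝒟 = ⟨2cη²·(∇F)(w), δ(∇F)⟩ + ⟨O(F_w²), δF⟩: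
  K1″ `CoarsenedDefectPairingAt` — `w ∈` print's regular fibre (window c·ε₀) and `NearCriticalPairOn (fibre) μ₁ μ₀ μ_b M w` with μ₁ = C₁θ(n)(k+1)(L^{−k})³ (sup of
       the derivatives of the curvature of the constrained minimiser w, faces included: bounded jumps; the factor k+1 = the cell's log-Lipschitz reading
       F-g12-1 ∕ `T3CurvGradLog.MinimiserCurvGradLogAt` of (9)), μ₀ = C₀θ(n)²(L^{−k})⁴ (cubic channel), μ_b = C_bθ(n)(k+1)(L^{−k})⁵ (smooth bulk remainder), M = O(1) k-independent (Wilson Hessian bound + linearisation + secant∕tangent defect of the curved fibre);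
       (first-order reading: on the OPEN competitor set around w the integrated inequality encodes the Euler–Lagrange equation of `A_K + 𝒟` at `w`
       paired with the structure bound `|d𝒟(w)[ξ]| ≤ μ₁‖δ_ξ∇F‖₁ + μ₀‖δ_ξF‖₁ + μ_b‖ξ‖₁`; the `M`-term only pays for second order);
  K2″ `KantorovichPairAt` — ONE RUN: near-critical in that pairing (basin one power of L^{−k} weaker than K1″ delivers) ⇒ gauge-orbit sup-distance to the
       minimiser ≤ C_G((k+1)·μ₁ + Lᵏ·μ₀ + L^{2k}·μ_b): the ℓ^∞
       norm of the TWO-derivative background Green's function G_k𝒥* is O(log L^k) = O(k+1) (Calderón–Zygmund endpoint; print: [Balaban CMP 99 (1985)] Thm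
       3.1∕3.3 (3.43)–(3.45) p.398 — Hölder bounds on ζ∇G′∇*λ with the ε-loss constant B′₀(ε), and [CMP 96 (1984)] Prop. 2.2 (2.67) p.234), ‖G_kℱ*‖ ≲ Lᵏ, ‖G_k‖ ≲ L^{2k};
  `LogAbsorb` — (k+1)²L^{−k} ≤ C_a (L^{−k})^{a₁} (two logarithms: K1″'s log-Lipschitz curvature gradient × K2″'s CZ endpoint; any a₁ < 1; instance a₁ = 1∕2, C_a = 7 PROVED);
  §4 `minimiserCauchyAt_of_pairing` : K1″ → K2″ → LogAbsorb → (θ(n) ≤ ϑ₀ε₀ guard) → MinimiserCauchyAt F γ ε₀ b₀ p₀ a₁ — PROVED.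
NO lift, NO K3, NO dependence on 19200's `SmoothLiftAt`: the comparison map is the canonical `coarsenField` and the only two-run object is 𝒟.
WHAT THIS IS NOT: no estimate of Bałaban's is asserted; K1″∕K2″ are hypothesis schemas; the proofs are the composition §4 and the arithmetic instance §3.
Seat folder only; never landed.

References: T. Bałaban, CMP 102 (1985) 277–309 [Balaban1985Variational] Thm 1 (8)–(10) p.279; CMP 99 (1985) 389–434 [Balaban1985PropagatorsBackground]
Thm 3.1∕3.3 (3.42)–(3.47) p.397–399; CMP 96 (1984) 223–250 [Balaban1984PropagatorsII] Prop. 2.2 (2.67) p.234; CMP 98 (1985) 17–51 [Balaban1985Averaging] (8) p.19;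
CMP 109 (1987) 249 [Balaban1987RG1] (0.4), (0.11) p.253; M. Lüscher, P. Weisz, CMP 97 (1985) 59–77 (doi:10.1007/bf01205792); T. DeGrand, C. DeTar, Lattice
Methods for QCD (2006) §10.2.1 p.155; C. King, CMP 102 (1986) 649–677 [King1986] Prop. 3.8 p.664.
-/

noncomputable section

open scoped Matrix.Norms.L2Operator
open Literature.MathematicalPhysics.QuantumFieldTheory.Balaban1983to89
open Literature.MathematicalPhysics.QuantumFieldTheory.Balaban1983to89.T3ContinuumYM3Torus
open Literature.MathematicalPhysics.QuantumFieldTheory.Balaban1983to89.T3UnitLawDensityEML (ℰp)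
open Literature.MathematicalPhysics.QuantumFieldTheory.Balaban1983to89.T3UnitScaleTilt
open Literature.MathematicalPhysics.QuantumFieldTheory.Balaban1983to89.T3PrintedRegularMinimiser
open Literature.MathematicalPhysics.QuantumFieldTheory.Balaban1983to89.T3AlphaInputsACTwoRun
open Literature.MathematicalPhysics.QuantumFieldTheory.Balaban1983to89.B10Eq27TorusAxialLog (toUField unitsField)
open Literature.MathematicalPhysics.QuantumFieldTheory.Balaban1983to89.B10Eq68TorusRegularity (covDerivT covDivT plaqFT)

namespace Summit.QuantumFields.YangMills.Cruxes.FluctuationComparisonRegPr.Ideate1DefectResponse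

variable (F : T3Family)

/-! ## §1 The structured pairing (test quantities of the first variation of the defect functional 𝒟) -/

/-- **ℓ¹ DISTANCE OF THE COVARIANT CURVATURE GRADIENTS** of two configurations of one run: `Σ_{x,κ,μ,ν} ‖(D_κ F_{μν})(W)(x) − (D_κ F_{μν})(w)(x)‖`
(covariant backward derivatives (1.1) of the plaquette fields (1.2), `SU(2)` read in `M₂(ℂ)`, operator norm; unit-lattice form `η = 1`).  It dominates the
`D*F`-channel `Σ_b ‖(D*F)(W)(b) − (D*F)(w)(b)‖` (`covDivT` is a signed sub-sum).  This is the test quantity against which the leading (dimension-6) part of the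
first variation of the one-step defect functional is bounded by `sup|∇F(w)|`. [cite: Balaban1985RegularSpaces, (1.1)-(1.2) p.76] -/
def curvGradDist {K' : ℕ} (W w : GaugeField (F.P K') 0 (Matrix.specialUnitaryGroup (Fin 2) ℂ)) : ℝ :=
  ∑ x : Site (F.P K') 0, ∑ κ : Fin (F.P K').d, ∑ μ : Fin (F.P K').d, ∑ ν : Fin (F.P K').d,
    ‖covDerivT 1 (unitsField (toUField W)) κ (plaqFT (unitsField (toUField W)) μ ν) x -
      covDerivT 1 (unitsField (toUField w)) κ (plaqFT (unitsField (toUField w)) μ ν) x‖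

/-- **ℓ¹ PLAQUETTE DISTANCE** `Σ_p |w(∂p)·W(∂p)⁻¹ − 1|` (test quantity of the cubic `F³` channel). [cite: Balaban1985Averaging, (9) p.19] -/
def plaqDist {K' : ℕ} (W w : GaugeField (F.P K') 0 (Matrix.specialUnitaryGroup (Fin 2) ℂ)) : ℝ :=
  ∑ p : Plaq (F.P K') 0, dist1 (GaugeField.plaqHol w p * (GaugeField.plaqHol W p)⁻¹)

/-- **ℓ¹ BOND DISTANCE** `Σ_b |w(b)W(b)⁻¹ − 1|` (test quantity of the smooth bulk remainder of the first variation of 𝒟). [cite: Balaban1985Averaging, (8) p.19] -/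
def bondDist {K' : ℕ} (W w : GaugeField (F.P K') 0 (Matrix.specialUnitaryGroup (Fin 2) ℂ)) : ℝ :=
  ∑ b : PBond (F.P K') 0, dist1 (w b * (W b)⁻¹)

/-- **ℓ² BOND DISTANCE SQUARED** `Σ_b |w(b)W(b)⁻¹ − 1|²` (all second-order terms: the Wilson Hessian bound, linearisation errors of
the test quantities, and the secant-vs-tangent defect of the curved fibre — `M = O(1)`, k-INDEPENDENT). [cite: Balaban1985Averaging, (8) p.19] -/
def bondDistSq {K' : ℕ} (W w : GaugeField (F.P K') 0 (Matrix.specialUnitaryGroup (Fin 2) ℂ)) : ℝ :=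
  ∑ b : PBond (F.P K') 0, dist1 (w b * (W b)⁻¹) ^ 2

/-- **STRUCTURED NEAR-CRITICALITY ON A SET** (derivative-free form of «the constrained Euler–Lagrange residual of `A` at `w` is
`𝒥*m + ℱ*n + r` with `‖m‖_∞ ≤ μ₁`, `‖n‖_∞ ≤ μ₀`, `‖r‖_∞ ≤ μ_b`», `𝒥` = linearised curvature-GRADIENT map (two derivatives), `ℱ` = linearised
curvature map (one derivative)): no competitor `W ∈ S` lowers the Wilson action below `A(w)` by more than
`μ₁·curvGradDist W w + μ₀·plaqDist W w + μ_b·bondDist W w + M·bondDistSq W w`.  Along curves in `S` through `w` the `M`-term is `o(t)`, so on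
an `S` containing a fibre-neighbourhood of `w` this ENCODES the first-order structured condition whatever the size of `M`; conversely the exact
Euler–Lagrange equation of `A + 𝒟` at its minimiser `w` plus the structure of `d𝒟(w)` give it for ALL `W ∈ S` with `M = ½ sup‖Hess A‖ + O(μ) = O(1)`.
[folklore] -/
def NearCriticalPairOn {K' : ℕ} (S : Set (GaugeField (F.P K') 0 (Matrix.specialUnitaryGroup (Fin 2) ℂ))) (μ₁ μ₀ μb M : ℝ)
    (w : GaugeField (F.P K') 0 (Matrix.specialUnitaryGroup (Fin 2) ℂ)) : Prop :=
  ∀ W ∈ S, wilsonAction4 w - wilsonAction4 W ≤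
    μ₁ * curvGradDist F W w + μ₀ * plaqDist F W w + μb * bondDist F W w + M * bondDistSq F W w

/-! ## §2 The two schemas (hypotheses, never asserted) and the logarithm guard -/

/-- **K1″ — THE COARSENED FINE MINIMISER IS STRUCTURALLY NEAR-CRITICAL (crux, rank 2; two runs enter ONLY through the one-step defect functional)**:
for every cut-off `K`, height `n ≤ K` with `θ(n) ≤ ϑ₀·ε₀`, `θ(n)`-small datum `V` and every minimiser `U′` of the Wilson action over print's regular fibre
(6)(ε₀) of `V` in run `K+1`, the canonical coarsening `w = coarsenField U′` lies in run `K`'s regular fibre of `V` with window `c·ε₀` and is near-critical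
there in the structured pairing with `μ₁ = C₁θ(n)·(k+1)·(L^{−k})³`, `μ₀ = C₀θ(n)²(L^{−k})⁴`, `μ_b = C_bθ(n)·(k+1)·(L^{−k})⁵`, `M = O(1)` (`k = K − n`;
the factor `k+1` is the LOG-LIPSCHITZ reading of the curvature-gradient bound (9) for constrained minimisers — cell finding F-g12-1, tree schema
`T3CurvGradLog.MinimiserCurvGradLogAt`: (9) holds at `β < 1` only, with `B₄(β) = O((1−β)⁻¹)`).  Mechanism:
`w = argmin (A_K + 𝒟)` on the fibre (semigroup of averages + min–min, exact; `𝒟 := L^{4−d}·min_{one-step regular lifts} A_{K+1} − A_K`, d = 3), the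
first variation of the gauge-, centre-reflection- and axis-permutation-invariant (tree: `BlockAveraging.avgFun_creflect`, `avgFun_permute`) quasi-local
analytic 𝒟 has NO dimension-4 part (consistency) and NO dimension-5 part (hyperoctahedral + gauge invariance: «no dimension-five operators»), so
`d𝒟(w)[ξ] = ⟨m, δ_ξ∇F⟩ + ⟨n, δ_ξF⟩ + ⟨r, ξ⟩` with `|m| ≲ sup_{j≥1}|∇ʲF(w)| = O(θ(n)(k+1)L^{−3k})` INCLUDING at block faces (kinks of a constrained
minimiser are bounded jumps of `∇F`), `|n| ≲ |F(w)|²`, `|r| ≲ θ(n)(k+1)L^{−5k}`; window bookkeeping by [Balaban1985Averaging] (8) and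
[Balaban1985Variational] (9)–(10).  UNPRINTED as a statement; every ingredient is one-run print plus the Symanzik classification of 𝒟.  Why it might fail: the inner one-step
minimisation defining `A^{(1)}(W)` must be analytic on the whole competitor window `c·ε₀` (one-step case of [Balaban1985Variational] Thm 1, `c ≤ 1∕B`),
and quasi-locality of 𝒟 must come with summable coefficients (every higher-dimension channel re-splits as «two derivatives on ξ, the rest on w»).
[cite: Balaban1985Variational, Thm 1 (8)-(10) p.279] -/
def CoarsenedDefectPairingAt (γ ε₀ b₀ p₀ ϑ₀ c C₁ C₀ Cb M : ℝ) : Prop :=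
  ∀ (K n : ℕ) (h : n ≤ K) (V : GaugeField (F.P n) 0 (Matrix.specialUnitaryGroup (Fin 2) ℂ)),
    θBal F.L γ b₀ p₀ n ≤ ϑ₀ * ε₀ → PlaqSmall (θBal F.L γ b₀ p₀ n) V →
      ∀ U' ∈ regFibrePr F n (K + 1) (h.trans (Nat.le_succ K)) ε₀ V,
        wilsonAction4 U' = minActionRegPr F n (K + 1) (h.trans (Nat.le_succ K)) ε₀ V →
          coarsenField F K U' ∈ regFibrePr F n K h (c * ε₀) V ∧
          NearCriticalPairOn F (regFibrePr F n K h (c * ε₀) V)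
            (C₁ * θBal F.L γ b₀ p₀ n * (((K - n : ℕ) : ℝ) + 1) * (((F.L : ℝ) ^ (K - n))⁻¹) ^ 3)
            (C₀ * θBal F.L γ b₀ p₀ n ^ 2 * (((F.L : ℝ) ^ (K - n))⁻¹) ^ 4)
            (Cb * θBal F.L γ b₀ p₀ n * (((K - n : ℕ) : ℝ) + 1) * (((F.L : ℝ) ^ (K - n))⁻¹) ^ 5) M (coarsenField F K U')

/-- **K2″ — ONE-RUN KANTOROVICH IN THE STRUCTURED PAIRING, WITH THE CALDERÓN–ZYGMUND LOGARITHM (crux, rank 3)**: in ONE cut-off `K′`, at height `n` with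
`θ(n) ≤ ϑ₀·ε₀`, for a `θ(n)`-small datum `V`: every configuration `w` of print's regular fibre (window `c·ε₀`) that is `(μ₁, μ₀, M)`-near-critical there in
the structured pairing, with `μ₁ ≤ ρ₁ε₀(L^{−k′})²`, `μ₀ ≤ ρ₀ε₀(L^{−k′})³`, `μ_b ≤ ρ_bε₀(L^{−k′})⁴` (`k′ = K′ − n`; Kantorovich basin: one power of
`L^{−k′}` WEAKER than K1″ delivers, so logarithms are harmless; what Newton–Kantorovich needs is `L^{2k′}·((k′+1)μ₁ + L^{k′}μ₀ + L^{2k′}μ_b) ≪ 1`), is within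
gauge-orbit sup-distance `C_G·((k′+1)·μ₁ + L^{k′}·μ₀ + L^{2k′}·μ_b)` of EVERY minimiser over the (ε₀)-fibre.  `(k′+1)` = the ℓ^∞→ℓ^∞ norm of the
two-derivative background Green's function `G_{k′}𝒥*` (kernel `≲ d(x,y)^{−3}e^{−δd(x,y)/L^{k′}}` on the unit lattice: the logarithm of the block scale —
Calderón–Zygmund endpoint), `L^{k′}` = that of `G_{k′}ℱ*`, `L^{2k′}` = that of `G_{k′}` ([Balaban1985RegularSpaces] (1.33)); the minimiser is print's
unique critical orbit and lies in the `c·ε₀` window by (9)–(10) once `θ(n) ≤ ϑ₀ε₀`; Newton–Kantorovich closes because `L^{2k′}·(k′+1)μ₁ ≪ 1`.  Printed IN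
KIND for one run (propagator bounds + Thm 1); never needs a second cut-off.  Why it might fail: the endpoint (ℓ^∞) form of the second-derivative
propagator bound is printed with an `ε`-loss (`B′₀(ε)`, (3.44)) — the dyadic resummation into ONE logarithm is folklore Calderón–Zygmund, to be redone
on Bałaban's random-walk expansion. [cite: Balaban1985PropagatorsBackground, Thm 3.3 p.399] -/
def KantorovichPairAt (γ ε₀ b₀ p₀ ϑ₀ c ρ₁ ρ₀ ρb M C_G : ℝ) : Prop :=
  ∀ (K' n : ℕ) (h : n ≤ K') (V : GaugeField (F.P n) 0 (Matrix.specialUnitaryGroup (Fin 2) ℂ)),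
    θBal F.L γ b₀ p₀ n ≤ ϑ₀ * ε₀ → PlaqSmall (θBal F.L γ b₀ p₀ n) V →
      ∀ μ₁ μ₀ μb : ℝ, 0 ≤ μ₁ → μ₁ ≤ ρ₁ * ε₀ * (((F.L : ℝ) ^ (K' - n))⁻¹) ^ 2 → 0 ≤ μ₀ → μ₀ ≤ ρ₀ * ε₀ * (((F.L : ℝ) ^ (K' - n))⁻¹) ^ 3 →
        0 ≤ μb → μb ≤ ρb * ε₀ * (((F.L : ℝ) ^ (K' - n))⁻¹) ^ 4 →
        ∀ w ∈ regFibrePr F n K' h (c * ε₀) V, NearCriticalPairOn F (regFibrePr F n K' h (c * ε₀) V) μ₁ μ₀ μb M w →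
          ∀ U ∈ regFibrePr F n K' h ε₀ V, wilsonAction4 U = minActionRegPr F n K' h ε₀ V →
            orbitDistOn F Set.univ w U ≤
              C_G * ((((K' - n : ℕ) : ℝ) + 1) * μ₁ + (F.L : ℝ) ^ (K' - n) * μ₀ + ((F.L : ℝ) ^ (K' - n)) ^ 2 * μb)

/-- **THE LOGARITHM GUARD** (squared: one logarithm from K1″'s curvature-gradient bound, one from K2″'s Calderón–Zygmund endpoint):
`(k+1)²·L^{−k} ≤ C_a·(L^{−k})^{a₁}` for all `k` — true for every `a₁ < 1` with `C_a = C_a(L, a₁)`; §3 proves the instance `a₁ = 1∕2`, `C_a = 7`. [folklore] -/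
def LogAbsorb (a₁ C_a : ℝ) : Prop :=
  ∀ k : ℕ, ((k : ℝ) + 1) ^ 2 * ((F.L : ℝ) ^ k)⁻¹ ≤ C_a * (((F.L : ℝ) ^ k)⁻¹) ^ a₁

/-! ## §3 The instance `a₁ = 1∕2` of the logarithm guard (PROVED: `(k+1)⁴ ≤ 49·2ᵏ ≤ 49·Lᵏ`) -/

/-- `(k+1)⁴ ≤ 49·2ᵏ`. [folklore] -/
theorem pow_four_succ_le (k : ℕ) : (k + 1) ^ 4 ≤ 49 * 2 ^ k := by
  induction k with
  | zero => norm_num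
  | succ k ih =>
    rcases Nat.lt_or_ge k 5 with hk | hk
    · interval_cases k <;> norm_num
    · have h2 : (k + 2) ^ 4 ≤ 2 * (k + 1) ^ 4 := by
        have h25 : 25 ≤ k * k := by nlinarith
        nlinarith [h25, hk, Nat.zero_le k]
      calc (k + 1 + 1) ^ 4 = (k + 2) ^ 4 := by ring
        _ ≤ 2 * (k + 1) ^ 4 := h2
        _ ≤ 2 * (49 * 2 ^ k) := Nat.mul_le_mul_left 2 ih
        _ = 49 * 2 ^ (k + 1) := by ring

/-- **`LogAbsorb F (1∕2) 7`** (PROVED). [folklore] -/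
theorem logAbsorb_half : LogAbsorb F (1 / 2) 7 := by
  intro k
  have hL2 : (2 : ℝ) ≤ F.L := by exact_mod_cast F.hL.2
  have hL : (0 : ℝ) < F.L := by linarith
  set y : ℝ := (F.L : ℝ) ^ k with hy_def
  have hy : 0 < y := pow_pos hL k
  have hy4 : (((k : ℝ) + 1) ^ 2) ^ 2 ≤ 49 * y := by
    have h1 : ((k : ℝ) + 1) ^ 4 ≤ 49 * (2 : ℝ) ^ k := by exact_mod_cast pow_four_succ_le k
    have h2 : (2 : ℝ) ^ k ≤ y := pow_le_pow_left₀ (by norm_num) hL2 k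
    nlinarith
  set s : ℝ := (y⁻¹) ^ ((1 : ℝ) / 2) with hs_def
  have hs0 : 0 ≤ s := Real.rpow_nonneg (inv_nonneg.mpr hy.le) _
  have hs2 : s ^ 2 = y⁻¹ := by
    rw [hs_def, show ((1 : ℝ) / 2) = ((2 : ℕ) : ℝ)⁻¹ by norm_num]
    exact Real.rpow_inv_natCast_pow (inv_nonneg.mpr hy.le) two_ne_zero
  -- `((k+1)²·s)² = (k+1)⁴·y⁻¹ ≤ 49`, hence `(k+1)²·s ≤ 7`
  have hks : ((k : ℝ) + 1) ^ 2 * s ≤ 7 := by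
    have hsq : (((k : ℝ) + 1) ^ 2 * s) ^ 2 ≤ 7 ^ 2 := by
      rw [mul_pow, hs2]
      have : (((k : ℝ) + 1) ^ 2) ^ 2 * y⁻¹ ≤ 49 * y * y⁻¹ := mul_le_mul_of_nonneg_right hy4 (inv_nonneg.mpr hy.le)
      rw [mul_inv_cancel_right₀ hy.ne'] at this
      linarith
    have h0 : 0 ≤ ((k : ℝ) + 1) ^ 2 * s := by positivity
    nlinarith [hsq, h0]
  -- the claim `(k+1)²·y⁻¹ ≤ 7·s` is `(k+1)²·s·s ≤ 7·s`
  calc ((k : ℝ) + 1) ^ 2 * y⁻¹ = (((k : ℝ) + 1) ^ 2 * s) * s := by rw [← hs2]; ring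
    _ ≤ 7 * s := mul_le_mul_of_nonneg_right hks hs0

/-! ## §4 The composition: e1 from K1″, K2″ and the logarithm guard (PROVED) -/

/-- **BASIN ARITHMETIC**: `C·θ·ℓ·x^{m+1} ≤ ρ·ε₀·xᵐ` once `θ ≤ ϑ₀ε₀`, `ℓx ≤ ℓ²x ≤ C_a x^{a} ≤ C_a` (`0 ≤ a`, `x ≤ 1`) and `Cϑ₀C_a ≤ ρ`. [folklore] -/
theorem basin_arith {θ x a₁ C ϑ₀ ε₀ C_a ℓ ρ : ℝ} (hx : 0 < x) (hx1 : x ≤ 1) (ha0 : 0 ≤ a₁) (hθε : θ ≤ ϑ₀ * ε₀)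
    (hC : 0 ≤ C) (hε₀ : 0 ≤ ε₀) (hϑ₀ : 0 ≤ ϑ₀) (hℓ : 1 ≤ ℓ) (hlog : ℓ ^ 2 * x ≤ C_a * x ^ a₁) (hb : C * ϑ₀ * C_a ≤ ρ) (m : ℕ) :
    C * θ * ℓ * x ^ (m + 1) ≤ ρ * ε₀ * x ^ m := by
  have hxa1 : x ^ a₁ ≤ 1 := Real.rpow_le_one hx.le hx1 ha0
  have hℓ0 : 0 ≤ ℓ := le_trans zero_le_one hℓ
  have hCa : 0 ≤ C_a := by
    have h1 : 0 < ℓ ^ 2 * x := by positivity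
    have h2 : 0 < C_a * x ^ a₁ := lt_of_lt_of_le h1 hlog
    have h3 : 0 < x ^ a₁ := Real.rpow_pos_of_pos hx a₁
    exact (pos_of_mul_pos_left h2 h3.le).le
  have hℓx : ℓ * x ≤ C_a := by
    calc ℓ * x = 1 * (ℓ * x) := by ring
      _ ≤ ℓ * (ℓ * x) := mul_le_mul_of_nonneg_right hℓ (by positivity)
      _ = ℓ ^ 2 * x := by ring
      _ ≤ C_a * x ^ a₁ := hlog
      _ ≤ C_a * 1 := mul_le_mul_of_nonneg_left hxa1 hCa
      _ = C_a := mul_one _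
  calc C * θ * ℓ * x ^ (m + 1) = ((C * θ) * (ℓ * x)) * x ^ m := by ring
    _ ≤ ((C * (ϑ₀ * ε₀)) * C_a) * x ^ m := by
        apply mul_le_mul_of_nonneg_right _ (by positivity)
        exact mul_le_mul (mul_le_mul_of_nonneg_left hθε hC) hℓx (by positivity) (by positivity)
    _ = (C * ϑ₀ * C_a) * ε₀ * x ^ m := by ring
    _ ≤ ρ * ε₀ * x ^ m := by
        apply mul_le_mul_of_nonneg_right _ (by positivity)
        exact mul_le_mul_of_nonneg_right hb hε₀

/-- **THE ARITHMETIC OF §4** (pure real inequality): with `P·x = 1`, `0 < x ≤ 1`, `0 ≤ θ ≤ ϑ₀ε₀`, `a ≤ 1`, `1 ≤ ℓ` and the squared logarithm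
guard `ℓ²x ≤ C_a xᵃ`:  `C_G(ℓ·C₁θℓx³ + P·C₀θ²x⁴ + P²·C_bθℓx⁵) ≤ C_G(C₁C_a + C₀ϑ₀ε₀ + C_bC_a)·θ·x²·xᵃ`. [folklore] -/
theorem absorb_arith {θ x P a₁ C₁ C₀ Cb C_a ϑ₀ ε₀ C_G ℓ : ℝ}
    (hx : 0 < x) (hx1 : x ≤ 1) (hPx : P * x = 1) (hθ : 0 ≤ θ) (hθε : θ ≤ ϑ₀ * ε₀) (ha₁ : a₁ ≤ 1)
    (hC₁ : 0 ≤ C₁) (hC₀ : 0 ≤ C₀) (hCb : 0 ≤ Cb) (hC_G : 0 ≤ C_G) (hε₀ : 0 ≤ ε₀) (hϑ₀ : 0 ≤ ϑ₀) (hℓ : 1 ≤ ℓ)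
    (hlog : ℓ ^ 2 * x ≤ C_a * x ^ a₁) :
    C_G * (ℓ * (C₁ * θ * ℓ * x ^ 3) + P * (C₀ * θ ^ 2 * x ^ 4) + P ^ 2 * (Cb * θ * ℓ * x ^ 5)) ≤
      C_G * (C₁ * C_a + C₀ * ϑ₀ * ε₀ + Cb * C_a) * θ * x ^ 2 * x ^ a₁ := by
  have hxa0 : 0 ≤ x ^ a₁ := Real.rpow_nonneg hx.le a₁
  have hℓ0 : 0 ≤ ℓ := le_trans zero_le_one hℓ
  have hxxa : x ≤ x ^ a₁ := by
    have := Real.rpow_le_rpow_of_exponent_ge hx hx1 ha₁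
    rwa [Real.rpow_one] at this
  have hlog1 : ℓ * x ≤ C_a * x ^ a₁ := by
    calc ℓ * x = 1 * (ℓ * x) := by ring
      _ ≤ ℓ * (ℓ * x) := mul_le_mul_of_nonneg_right hℓ (by positivity)
      _ = ℓ ^ 2 * x := by ring
      _ ≤ C_a * x ^ a₁ := hlog
  have hterm₁ : ℓ * (C₁ * θ * ℓ * x ^ 3) ≤ C₁ * C_a * θ * x ^ 2 * x ^ a₁ := by
    have h0 : 0 ≤ C₁ * θ * x ^ 2 := by positivity
    calc ℓ * (C₁ * θ * ℓ * x ^ 3) = (C₁ * θ * x ^ 2) * (ℓ ^ 2 * x) := by ring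
      _ ≤ (C₁ * θ * x ^ 2) * (C_a * x ^ a₁) := mul_le_mul_of_nonneg_left hlog h0
      _ = C₁ * C_a * θ * x ^ 2 * x ^ a₁ := by ring
  have hterm₀ : P * (C₀ * θ ^ 2 * x ^ 4) ≤ C₀ * ϑ₀ * ε₀ * θ * x ^ 2 * x ^ a₁ := by
    have h0 : 0 ≤ C₀ * θ * x ^ 2 := by positivity
    calc P * (C₀ * θ ^ 2 * x ^ 4) = (C₀ * θ * x ^ 2) * (θ * x) * (P * x) := by ring
      _ = (C₀ * θ * x ^ 2) * (θ * x) := by rw [hPx, mul_one]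
      _ ≤ (C₀ * θ * x ^ 2) * ((ϑ₀ * ε₀) * x ^ a₁) :=
          mul_le_mul_of_nonneg_left (mul_le_mul hθε hxxa hx.le (by positivity)) h0
      _ = C₀ * ϑ₀ * ε₀ * θ * x ^ 2 * x ^ a₁ := by ring
  have htermb : P ^ 2 * (Cb * θ * ℓ * x ^ 5) ≤ Cb * C_a * θ * x ^ 2 * x ^ a₁ := by
    have h0 : 0 ≤ Cb * θ * x ^ 2 := by positivity
    calc P ^ 2 * (Cb * θ * ℓ * x ^ 5) = (Cb * θ * x ^ 2) * (ℓ * x) * (P * x) ^ 2 := by ring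
      _ = (Cb * θ * x ^ 2) * (ℓ * x) := by rw [hPx, one_pow, mul_one]
      _ ≤ (Cb * θ * x ^ 2) * (C_a * x ^ a₁) := mul_le_mul_of_nonneg_left hlog1 h0
      _ = Cb * C_a * θ * x ^ 2 * x ^ a₁ := by ring
  calc C_G * (ℓ * (C₁ * θ * ℓ * x ^ 3) + P * (C₀ * θ ^ 2 * x ^ 4) + P ^ 2 * (Cb * θ * ℓ * x ^ 5))
      ≤ C_G * (C₁ * C_a * θ * x ^ 2 * x ^ a₁ + C₀ * ϑ₀ * ε₀ * θ * x ^ 2 * x ^ a₁ + Cb * C_a * θ * x ^ 2 * x ^ a₁) :=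
        mul_le_mul_of_nonneg_left (add_le_add (add_le_add hterm₁ hterm₀) htermb) hC_G
    _ = C_G * (C₁ * C_a + C₀ * ϑ₀ * ε₀ + Cb * C_a) * θ * x ^ 2 * x ^ a₁ := by ring

/-- **e1 BY THE DEFECT-FUNCTIONAL RESPONSE** (PROVED composition): `CoarsenedDefectPairingAt` (K1″) ∧ `KantorovichPairAt` (K2″, run `K` only) ∧ `LogAbsorb`
∧ the guards (`θ(n) ≤ ϑ₀ε₀` for all `n` — true for `γ ≤ γ₁(ε₀)` since `θ(n) → 0`; `C₁ϑ₀C_a ≤ ρ₁`, `C₀ϑ₀²ε₀ ≤ ρ₀`, `C_bϑ₀C_a ≤ ρ_b` — Kantorovich basin;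
`0 ≤ a₁ ≤ 1`) ⇒ `MinimiserCauchyAt F γ ε₀ b₀ p₀ a₁` with constant `C_G·(C₁C_a + C₀ϑ₀ε₀ + C_bC_a)`:
`dist(coarsen U′, U) ≤ C_G((k+1)²C₁θx³ + Lᵏ·C₀θ²x⁴ + L^{2k}(k+1)·C_bθx⁵) ≤ C_G(C₁C_a + C₀ϑ₀ε₀ + C_bC_a)·θ·x²·xᵃ`, `x = L^{−k}` (`(k+1)²x ≤ C_a xᵃ`,
`Lᵏx⁴ = x³ ≤ x²xᵃ`).  No lift, no averaging-Lipschitz step, no two-run operator comparison: the only two-run input is K1″'s defect-functional pairing. -/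
theorem minimiserCauchyAt_of_pairing {γ ε₀ b₀ p₀ a₁ ϑ₀ c C₁ C₀ Cb M ρ₁ ρ₀ ρb C_G C_a : ℝ}
    (ha0 : 0 ≤ a₁) (ha₁ : a₁ ≤ 1) (hε₀ : 0 ≤ ε₀) (hϑ₀ : 0 ≤ ϑ₀) (hC₁ : 0 ≤ C₁) (hC₀ : 0 ≤ C₀) (hCb : 0 ≤ Cb) (hC_G : 0 ≤ C_G)
    (hθ0 : ∀ n, 0 ≤ θBal F.L γ b₀ p₀ n) (hθε : ∀ n, θBal F.L γ b₀ p₀ n ≤ ϑ₀ * ε₀)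
    (hbasin₁ : C₁ * ϑ₀ * C_a ≤ ρ₁) (hbasin₀ : C₀ * ϑ₀ ^ 2 * ε₀ ≤ ρ₀) (hbasinb : Cb * ϑ₀ * C_a ≤ ρb)
    (h1 : CoarsenedDefectPairingAt F γ ε₀ b₀ p₀ ϑ₀ c C₁ C₀ Cb M) (h2 : KantorovichPairAt F γ ε₀ b₀ p₀ ϑ₀ c ρ₁ ρ₀ ρb M C_G)
    (hlog : LogAbsorb F a₁ C_a) :
    MinimiserCauchyAt F γ ε₀ b₀ p₀ a₁ := by
  refine ⟨C_G * (C₁ * C_a + C₀ * ϑ₀ * ε₀ + Cb * C_a), fun K n h V hV U hU hUmin U' hU' hU'min => ?_⟩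
  have hL1 : (1 : ℝ) ≤ F.L := by exact_mod_cast F.hL.2.le
  have hL : (0 : ℝ) < F.L := lt_of_lt_of_le one_pos hL1
  have hP : (0 : ℝ) < (F.L : ℝ) ^ (K - n) := pow_pos hL _
  have hx : (0 : ℝ) < ((F.L : ℝ) ^ (K - n))⁻¹ := inv_pos.mpr hP
  have hx1 : ((F.L : ℝ) ^ (K - n))⁻¹ ≤ 1 := inv_le_one_of_one_le₀ (one_le_pow₀ hL1)
  have hPx : (F.L : ℝ) ^ (K - n) * ((F.L : ℝ) ^ (K - n))⁻¹ = 1 := mul_inv_cancel₀ hP.ne'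
  have hθn : 0 ≤ θBal F.L γ b₀ p₀ n := hθ0 n
  have hθε' : θBal F.L γ b₀ p₀ n ≤ ϑ₀ * ε₀ := hθε n
  have hℓ : (1 : ℝ) ≤ ((K - n : ℕ) : ℝ) + 1 := by
    have : (0 : ℝ) ≤ ((K - n : ℕ) : ℝ) := Nat.cast_nonneg _
    linarith
  have hlogk : (((K - n : ℕ) : ℝ) + 1) ^ 2 * ((F.L : ℝ) ^ (K - n))⁻¹ ≤ C_a * (((F.L : ℝ) ^ (K - n))⁻¹) ^ a₁ := hlog (K - n)
  -- K1″: the coarsened fine minimiser is structurally near-critical in run `K`'s regular fibre (window `c·ε₀`)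
  obtain ⟨hwmem, hnc⟩ := h1 K n h V hθε' hV U' hU' hU'min
  -- the three pairing coefficients lie in K2″'s basin
  have hb₁ : C₁ * θBal F.L γ b₀ p₀ n * (((K - n : ℕ) : ℝ) + 1) * (((F.L : ℝ) ^ (K - n))⁻¹) ^ 3 ≤
      ρ₁ * ε₀ * (((F.L : ℝ) ^ (K - n))⁻¹) ^ 2 := by
    simpa using basin_arith hx hx1 ha0 hθε' hC₁ hε₀ hϑ₀ hℓ hlogk hbasin₁ 2
  have hb₀ : C₀ * θBal F.L γ b₀ p₀ n ^ 2 * (((F.L : ℝ) ^ (K - n))⁻¹) ^ 4 ≤ ρ₀ * ε₀ * (((F.L : ℝ) ^ (K - n))⁻¹) ^ 3 := by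
    have hq : C₀ * θBal F.L γ b₀ p₀ n ^ 2 ≤ ρ₀ * ε₀ :=
      calc C₀ * θBal F.L γ b₀ p₀ n ^ 2 ≤ C₀ * (ϑ₀ * ε₀) ^ 2 := mul_le_mul_of_nonneg_left (pow_le_pow_left₀ hθn hθε' 2) hC₀
        _ = (C₀ * ϑ₀ ^ 2 * ε₀) * ε₀ := by ring
        _ ≤ ρ₀ * ε₀ := mul_le_mul_of_nonneg_right hbasin₀ hε₀
    have hx43 : (((F.L : ℝ) ^ (K - n))⁻¹) ^ 4 ≤ (((F.L : ℝ) ^ (K - n))⁻¹) ^ 3 :=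
      pow_le_pow_of_le_one hx.le hx1 (by norm_num)
    calc C₀ * θBal F.L γ b₀ p₀ n ^ 2 * (((F.L : ℝ) ^ (K - n))⁻¹) ^ 4
        ≤ C₀ * θBal F.L γ b₀ p₀ n ^ 2 * (((F.L : ℝ) ^ (K - n))⁻¹) ^ 3 := mul_le_mul_of_nonneg_left hx43 (by positivity)
      _ ≤ (ρ₀ * ε₀) * (((F.L : ℝ) ^ (K - n))⁻¹) ^ 3 := mul_le_mul_of_nonneg_right hq (by positivity)
  have hbb : Cb * θBal F.L γ b₀ p₀ n * (((K - n : ℕ) : ℝ) + 1) * (((F.L : ℝ) ^ (K - n))⁻¹) ^ 5 ≤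
      ρb * ε₀ * (((F.L : ℝ) ^ (K - n))⁻¹) ^ 4 := by
    simpa using basin_arith hx hx1 ha0 hθε' hCb hε₀ hϑ₀ hℓ hlogk hbasinb 4
  -- K2″ in run `K`: the gauge-orbit distance of `w = coarsenField U′` to the minimiser `U`
  have hk := h2 K n h V hθε' hV
    (C₁ * θBal F.L γ b₀ p₀ n * (((K - n : ℕ) : ℝ) + 1) * (((F.L : ℝ) ^ (K - n))⁻¹) ^ 3)
    (C₀ * θBal F.L γ b₀ p₀ n ^ 2 * (((F.L : ℝ) ^ (K - n))⁻¹) ^ 4)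
    (Cb * θBal F.L γ b₀ p₀ n * (((K - n : ℕ) : ℝ) + 1) * (((F.L : ℝ) ^ (K - n))⁻¹) ^ 5)
    (by positivity) hb₁ (by positivity) hb₀ (by positivity) hbb
    (coarsenField F K U') hwmem hnc U hU hUmin
  -- absorb the two logarithms and the extra powers (pure arithmetic, `absorb_arith`)
  exact hk.trans (absorb_arith hx hx1 hPx hθn hθε' ha₁ hC₁ hC₀ hCb hC_G hε₀ hϑ₀ hℓ hlogk)

/-- **e1 WITH `a₁ = 1∕2`** from K1″ + K2″ alone (the logarithm guard discharged by `logAbsorb_half`, `C_a = 7`). -/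
theorem minimiserCauchyAt_half_of_pairing {γ ε₀ b₀ p₀ ϑ₀ c C₁ C₀ Cb M ρ₁ ρ₀ ρb C_G : ℝ}
    (hε₀ : 0 ≤ ε₀) (hϑ₀ : 0 ≤ ϑ₀) (hC₁ : 0 ≤ C₁) (hC₀ : 0 ≤ C₀) (hCb : 0 ≤ Cb) (hC_G : 0 ≤ C_G)
    (hθ0 : ∀ n, 0 ≤ θBal F.L γ b₀ p₀ n) (hθε : ∀ n, θBal F.L γ b₀ p₀ n ≤ ϑ₀ * ε₀)
    (hbasin₁ : C₁ * ϑ₀ * 7 ≤ ρ₁) (hbasin₀ : C₀ * ϑ₀ ^ 2 * ε₀ ≤ ρ₀) (hbasinb : Cb * ϑ₀ * 7 ≤ ρb)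
    (h1 : CoarsenedDefectPairingAt F γ ε₀ b₀ p₀ ϑ₀ c C₁ C₀ Cb M) (h2 : KantorovichPairAt F γ ε₀ b₀ p₀ ϑ₀ c ρ₁ ρ₀ ρb M C_G) :
    MinimiserCauchyAt F γ ε₀ b₀ p₀ (1 / 2) :=
  minimiserCauchyAt_of_pairing F (by norm_num) (by norm_num) hε₀ hϑ₀ hC₁ hC₀ hCb hC_G hθ0 hθε hbasin₁ hbasin₀ hbasinb h1 h2
    (logAbsorb_half F)

end Summit.QuantumFields.YangMills.Cruxes.FluctuationComparisonRegPr.Ideate1DefectResponse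

end
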